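import Summits.ResolutionOfSingularities.ResolutionOfSingularities.Theorems.CuspCutCells
import HarnessLib

/-!
# CuspCutCells2 — decomp-res node «CuspCut» (lens-2 g24, critic row 197 BOOKED 0), tree file 5/6 of the node

Content VERBATIM from the decomp-res lens-2 g24 node `HOME/decomp-res-lens-2/g24/CuspCut.lean` (pin 4f3dedd1; no
carry, imports the landed tree only; ns `…Theses.CuspCut` ↦ `…Theorems.CuspCut`); HOME =
run/shared/lean/pub/decomp-res; critic CRITIC-LEDGER row 197 BOOKED 0; landing orders INBOX :1164 / :1194 —
provenance, critic text and the lens header in full in the first file of the node, `CuspCutKernels`.  `--kind proof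
--supports stmt-ResolutionOfSingularities-29273`.

## This file

Continuation 2/2 of `CuspCutCells` (same namespace / sections of the node, cut at the tree's 400-line cap; section
variables / opens replayed): scopes `CuspX`, `Kernels` — carries `SeqCuspGen`, `SeqCuspSpec`, `CuspGenRungAt`,
`CuspGenericRung`, `CuspSpecialRung`, `cuspGenericRung_iff`, `cuspSpecialRung_iff`, `seqDimFour_one_iff`,
`isExitPt_of_cuspLeaf`, `cuspGenRungAt_of_engines`, `cuspGenericRung_of_engines`,
`cuspSpecialRung_of_oddSpecialRung`, `oddGenericRung_of_cuspGenericRung`.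

[WRITER NOTE (decomp-res writer g13): file split only (tree files ≤ 400 lines); sections, section variables / opens
and every declaration exactly as in the lens (the node's HOME-only dupNamespace-linter line is dropped; the
namespace-level `open` lines of the node are replayed in every part, the `open …Theses` line only in the Theses-cone
file `MaxContactCutCuspCut`); namespace renamed `…Theses.CuspCut` ↦ `…Theorems.CuspCut`.]

(Sources: Hironaka1964 Ch. III; CossartJannsenSaito2020 Thm 5.9, Ch. 2, Ch. 8–9; Cutkosky2009 Thm 5.6, Thm 7.2,
Lemma 7.3, §8; Kollar2007 §3.13 (3.111); CossartPiltant2008 Prop. 4.2; CossartPiltant2019 Rem. 3.2;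
EncinasVillamayor2000; BierstoneGrigorievMilmanWlodarczyk2011 §3.1; Moh1987; Hauser2010Kangaroo; Giraud1975.)
-/

open CategoryTheory AlgebraicGeometry TopologicalSpace IsLocalRing
open Literature.AlgebraicGeometry.Resolution
open Summit.ResolutionOfSingularities.ResolutionOfSingularities.Theorems
open Summit.ResolutionOfSingularities.ResolutionOfSingularities.Theorems.WeakOrderReduction
open Summit.ResolutionOfSingularities.ResolutionOfSingularities.Theorems.DeltaFaceCutClasses
open Summit.ResolutionOfSingularities.ResolutionOfSingularities.Theorems.RelativeDeltaCut
open Summit.ResolutionOfSingularities.ResolutionOfSingularities.Theorems.CurveLeafExit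
open Summit.ResolutionOfSingularities.ResolutionOfSingularities.Theorems.PinchCut
open Summit.ResolutionOfSingularities.ResolutionOfSingularities.Theorems.JetCut
open Summit.ResolutionOfSingularities.ResolutionOfSingularities.Theorems.PurityCut
open Summit.ResolutionOfSingularities.ResolutionOfSingularities.Theorems.SplitCut
open Summit.ResolutionOfSingularities.ResolutionOfSingularities.Theorems.CylinderCut
open Summit.ResolutionOfSingularities.ResolutionOfSingularities.Theorems.SpreadCut
open Summit.ResolutionOfSingularities.ResolutionOfSingularities.Theorems.CrossCut
open Summit.ResolutionOfSingularities.ResolutionOfSingularities.Theorems.DeepCrossCut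
open Summit.ResolutionOfSingularities.ResolutionOfSingularities.Theorems.OddCrossCut

namespace Summit.ResolutionOfSingularities.ResolutionOfSingularities.Theorems.CuspCut

namespace CuspX

/-! ### §E.2b  The graded statements of the CUSP cut (instances of §G with the cusp leaf) -/

/-- **`SeqCuspGen n`** — weak order reduction in dimension four at marking `n` for data ALL of whose top points are in
the decided classes of g23 or CUSP-CURVE points.  [DECIDED-MOD-PORT and MOD-(X**)(X***)(E**):
`cuspGenRungAt_of_engines`.]  STATEMENT SCHEMA (= `Leaf.SeqGen cuspLeaf n`). (Sources:
BierstoneGrigorievMilmanWlodarczyk2011 §3.1; CossartPiltant2008 Prop. 4.2; Hironaka1967.) -/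
def SeqCuspGen (n : ℕ) : Prop := Leaf.SeqGen cuspLeaf n

/-- **`SeqCuspSpec n`** — THE LOCATED CLASS: weak order reduction at marking `n` for data having a CUSP-SPECIAL core
top point.  [UNDECIDED · IDEA-NEEDED.]  STATEMENT SCHEMA (= `Leaf.SeqSpec cuspLeaf n`). (Sources: CossartPiltant2019
Rem. 3.2; Moh1987.) -/
def SeqCuspSpec (n : ℕ) : Prop := Leaf.SeqSpec cuspLeaf n

/-- `CuspGenRungAt n` — the decided rung at one marking. -/
def CuspGenRungAt (n : ℕ) : Prop := SeqDimFour 2 n → SeqCuspGen n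

/-- **`CuspGenericRung`** — the DECIDED-MOD-ENGINES half of `RungOne` (29273) for the cusp leaf.  [WEAKER ·
DECIDED-MOD-PORT(M+)·MOD-(X**)(X***)(E**): `cuspGenericRung_of_ports`.]  STATEMENT (decided piece). (Sources:
Hironaka1967; CossartPiltant2008 Prop. 4.2; CossartJannsenSaito2020.) -/
def CuspGenericRung : Prop := E 2 → ∀ n : ℕ, 1 ≤ n → SeqCuspGen n

/-- **`CuspSpecialRung`** — THE LOCATED RESIDUAL of this node: `E 2 →` weak order reduction for every marking and all
data with a cusp-special core top point.  [WEAKER BY LETTER than the tree's `OddX.OddSpecialRung` · UNDECIDED ·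
IDEA-NEEDED · cofinal ⇒ score 0.]  STATEMENT (located residual). (Sources: CossartPiltant2019 Rem. 3.2; Moh1987;
Giraud1975; Narasimhan1983.) -/
def CuspSpecialRung : Prop := E 2 → ∀ n : ℕ, 1 ≤ n → SeqCuspSpec n

/-- By letter. [folklore] -/
theorem cuspGenericRung_iff : CuspGenericRung ↔ Leaf.GenericRung cuspLeaf := Iff.rfl

/-- By letter. [folklore] -/
theorem cuspSpecialRung_iff : CuspSpecialRung ↔ Leaf.SpecialRung cuspLeaf := Iff.rfl

section Kernels

variable {n : ℕ}

/-! ### §E.2c  Kernels of the CUSP cut (instantiated from §G; 0 sorry) -/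

/-- **EXACT at each marking**: `SeqDimFour 1 n ⟺ SeqCuspGen n ∧ SeqCuspSpec n`. [folklore] -/
theorem seqDimFour_one_iff : SeqDimFour 1 n ↔ SeqCuspGen n ∧ SeqCuspSpec n :=
  Leaf.seqDimFour_one_iff (L := cuspLeaf)

/-- Under the engines (M) (C) (G) (S) (Cyl) (JCyl) (Γ) (X) (X**) (N) (X***) and the NEW (E**) (T) every point of the
cusp leaf is a curve-exit point or a component-exit point. [folklore] -/
theorem isExitPt_of_cuspLeaf (hM : MonomialPinchExit) (hC : FlatConeExit) (hGE : GrandExit) (hSE : SplitConeExit)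
    (hCE : CylinderExit) (hJE : JetCylinderExit) (hΓE : SpreadExit) (hXE : CrossExit) (hDXE : DeepCrossExit)
    (hNE : NodeExit) (hOXE : OddCrossExit) (hCuE : CuspExit) (hTaE : TameTwoExit)
    (hn : 2 ≤ n) ⦃Y : Scheme.{0}⦄ (hY : Scheme.IsRegular Y) ⦃I : Y.IdealSheafData⦄ ⦃y : Y⦄ (h : cuspLeaf I n y) :
    IsCurveExitPt I n y ∨ IsComponentExitPt I n y := by
  rcases h with h | h | h
  · exact OddX.isExitPt_of_oddLeaf hM hC hGE hSE hCE hJE hΓE hXE hDXE hNE hOXE hn hY h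
  · exact Or.inl (isCurveExitPt_of_isCuspCurvePt hCuE hY h)
  · exact Or.inl (isCurveExitPt_of_isTameCurvePt hTaE hY h)

/-- **THE ENGINES AT WORK**: the five tree engines, (M) … (X***), the NEW (E**) and the COMPONENT port give
`CuspGenRungAt n` for `n ≥ 2`. [folklore] -/
theorem cuspGenRungAt_of_engines (hV : VeryNearCutClasses.VeryNearExit) (hD : DeltaPackageExit)
    (hU : UniformCurvePackageExit) (hR : RelCurvePackageExit) (hN : NormalConeJumpExit)
    (hM : MonomialPinchExit) (hC : FlatConeExit) (hGE : GrandExit) (hSE : SplitConeExit)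
    (hCE : CylinderExit) (hJE : JetCylinderExit) (hΓE : SpreadExit) (hXE : CrossExit) (hDXE : DeepCrossExit)
    (hNE : NodeExit) (hOXE : OddCrossExit) (hCuE : CuspExit) (hTaE : TameTwoExit)
    (hP : ComponentPackagePort n) (hn : 2 ≤ n) : CuspGenRungAt n :=
  Leaf.genRungAt_of_componentPort (L := cuspLeaf) hV hD hU hR hN
    (isExitPt_of_cuspLeaf hM hC hGE hSE hCE hJE hΓE hXE hDXE hNE hOXE hCuE hTaE hn) hP hn

/-- **`CuspGenericRung` is DECIDED modulo the typed pieces**: engines (as hypotheses; (X**) (X***) decided on paper,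
(E**) decided in kernel for the inhabitant and by strategy + evidence for the kind, (T) reduced on paper to print over
perfect fields), the component port at every marking `≥ 2`, the order-one contact port. [folklore] -/
theorem cuspGenericRung_of_engines (hV : VeryNearCutClasses.VeryNearExit) (hD : DeltaPackageExit)
    (hU : UniformCurvePackageExit) (hR : RelCurvePackageExit) (hN : NormalConeJumpExit)
    (hM : MonomialPinchExit) (hC : FlatConeExit) (hGE : GrandExit) (hSE : SplitConeExit)
    (hCE : CylinderExit) (hJE : JetCylinderExit) (hΓE : SpreadExit) (hXE : CrossExit) (hDXE : DeepCrossExit)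
    (hNE : NodeExit) (hOXE : OddCrossExit) (hCuE : CuspExit) (hTaE : TameTwoExit)
    (hP : ∀ n : ℕ, 2 ≤ n → ComponentPackagePort n) (h1 : FaceFormCutClasses.OrderOneContact) : CuspGenericRung :=
  Leaf.genericRung_of_componentPort (L := cuspLeaf) hV hD hU hR hN
    (fun _ hn => isExitPt_of_cuspLeaf hM hC hGE hSE hCE hJE hΓE hXE hDXE hNE hOXE hCuE hTaE hn) hP h1

/-! ### §E.3  EXACT RE-LOCATIONS (the residual shrinks; equivalent modulo the cusp decided half) -/

/-- **REFINEMENT EDGE (hypothesis-free)**: the tree's g23 residual implies g24's — `OddX.OddSpecialRung →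
CuspSpecialRung` (WEAKER BY LETTER). [folklore] -/
theorem cuspSpecialRung_of_oddSpecialRung (h : OddX.OddSpecialRung) : CuspSpecialRung :=
  Leaf.specialRung_mono oddLeaf_le_cuspLeaf (OddX.oddSpecialRung_iff.mp h)

/-- The cusp decided half contains g23's: `CuspGenericRung → OddX.OddGenericRung`. [folklore] -/
theorem oddGenericRung_of_cuspGenericRung (h : CuspGenericRung) : OddX.OddGenericRung :=
  OddX.oddGenericRung_iff.mpr (Leaf.genericRung_anti oddLeaf_le_cuspLeaf h)

end Kernels

end CuspX

end Summit.ResolutionOfSingularities.ResolutionOfSingularities.Theorems.CuspCut
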